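import Literature.NumberTheory.DiophantineGeometry.BelyiMapSignatureTwoThreeFive
import HarnessLib

/-!
# A covering of signature `(2, 3, 7)`: one Kummer layer over the `j`-map of `X₁(7)`

Topic: `Literature/NumberTheory/DiophantineGeometry`. Theorem-only file (no definition, no named
fact), the fourth of the chain `BelyiMapSignatureTwoThreeEven` (`(2, 3, 2m)`, dihedral seed),
`BelyiMapSignatureTwoThreeTriple` (`(2, 3, 3m)`, tetrahedral seed), `BelyiMapSignatureTwoThreeFive`
(`(2, 3, 5m)`, icosahedral seed) attached to the named fact `AbcWave0.darmonGranville1995_thm_2` and to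
Pasten's Lemma 6.10 (`Literature.NumberTheory.EllipticCurves.PastenShimura2024_lemma_6_10`). It
constructs EXPLICITLY, in the tree's function-field language and in exactly the shape consumed by
`finite_properSolutions_of_belyiMap_of_faltings` (`AbcDarmonGranvilleSignatureReduction`), a covering of
`ℙ¹` of signature `(2, 3, 7)` over a number field (`AlgFunctionField.exists_belyiMap_signature_two_three_seven`),
whence Darmon–Granville's Theorem 2 for every signature `(p, q, r)` with `2 ∣ p`, `3 ∣ q`, `7 ∣ r` — in
particular `(2, 3, 7)` itself (the equation `x² + y³ = z⁷`) and `(r, 2, 3)` for every `r` divisible by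
`7` — modulo Faltings' theorem ONLY (`finite_properSolutions_signature_two_three_seven_of_faltings`,
`finite_properSolutions_signature_seven_two_three_of_faltings`), and, with the three companions, for all
`r ≥ 7` not prime to `210` (`finite_properSolutions_signature_r_two_three_of_faltings_of_not_coprime`).
No Riemann existence theorem is used. (`(2, 3, 7)` is hyperbolic, so ONE covering serves every multiple
signature by `finite_properSolutions_of_dvd`; no family in a parameter `m` is needed here.)

Why this goes beyond the companions. The triangle group `Δ(2, 3, 7)` is perfect and, `7` being prime,
has no proper triangle subgroup of finite index other than the sporadic ones inside the Hurwitz group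
of Klein's quartic; every covering of signature `(2, 3, 7)` has non-solvable monodromy (a quotient of
`Δ(2, 3, 7)` onto a group containing `PSL₂(𝔽₇)`), so no tower of Kummer layers over a cyclic, dihedral,
tetrahedral or icosahedral seed reaches it. The classical source is the modular curve `X(7) → X(1)`
(Klein's quartic, degree `168`, genus `3`). This file realises that covering WITHOUT a model of the
quartic: the intermediate curve `X₁(7) = X(7)/C₇` has genus `0`, is defined over `ℚ`, and its `j`-map
`X₁(7) → X(1)` (degree `24`) is already ramified UNIFORMLY of index `2` over `j = 1728` and `3` over
`j = 0` (`Γ₁(7)` has no elliptic elements), its six cusps having widths `7, 7, 7` (at `d = 0, 1, ∞`)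
and `1, 1, 1` (at the roots of `d³ - 8 d² + 5 d + 1`, rational over `ℚ(ζ₇)⁺`); one Kummer layer of
degree `7` branched exactly at the three cusps of width `1` makes the signature `(2, 3, 7)`.

## The construction

The `j`-map of `X₁(7)` is read off the universal elliptic curve with a point of order `7`, Tate's normal
form `E_d : y² + (1 - c) x y - b y = x³ - b x²`, `b = d³ - d²`, `c = d² - d` (Kubert 1976, Table 3):
`c₄(E_d) = d⁸ - 12 d⁷ + 42 d⁶ - 56 d⁵ + 35 d⁴ - 14 d² + 4 d + 1`,
`c₆(E_d) = -(d¹² - 18 d¹¹ + 117 d¹⁰ - 354 d⁹ + 570 d⁸ - 486 d⁷ + 273 d⁶ - 222 d⁵ + 174 d⁴ - 46 d³ - 15 d² + 6 d + 1)`,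
`Δ(E_d) = d⁷ (d - 1)⁷ (d³ - 8 d² + 5 d + 1)`, `1728 Δ = c₄³ - c₆²`.
With the forms `ℌ = -c₄` (degree `8`), `𝔗 = -c₆` (degree `12`), the cusp form `𝔠 = X³ - 8 X² + 5 X + 1`
and `𝔡 = X⁷ (1 - X)⁷ 𝔠 = -Δ` (degree `17`) this is the **Klein-shaped identity** `ℌ³ + 𝔗² = 1728 𝔡`
(`lvH_pow_add_lvT_pow`, by `ring`), and the seed on the line `K(v)` is
`𝔤 = 𝔗(v)²/(1728 𝔡(v)) = 1 - j(E_v)/1728`, `𝔤 - 1 = -ℌ(v)³/(1728 𝔡(v))`,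
with zeros of order `2` (at `𝔗(v) = 0`), zeros of `𝔤 - 1` of order `3` (at `ℌ(v) = 0`), poles of order
`7` at `v = 0, 1, ∞` and of order `1` at `𝔠(v) = 0`, and unramified over every other closed point of the
`𝔤`-line (`seedS_cases`, `seedS_elsewhere` — by the tool `pullback_separable` of the even companion with
`A = 𝔗²`, `B = 1728 𝔡`, `A - B = -ℌ³`, Wronskian `A'B - AB' = 1728 𝔗 · X⁶ (1 - X)⁶ · (-7 ℌ²)`). The
polynomial algebra is: ONE Euclidean computation `IsCoprime ℌ 𝔠` (`isCoprime_lvH_lvC`, a Bézout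
identity with denominator `49`), the values `ℌ(0) = ℌ(1) = -1`, the two **Wronskian identities**
`2 𝔗' X (1 - X) 𝔠 - 𝔗 𝔢 = -7 ℌ²`, `3 ℌ' X (1 - X) 𝔠 - ℌ 𝔢 = 7 𝔗` where `𝔡' = X⁶ (1 - X)⁶ 𝔢`,
`𝔢 = -17 X⁴ + 138 X³ - 147 X² + 26 X + 7` (all by `ring`), whence the pairwise coprimality of
`𝔗, ℌ, 𝔡` and the separability of `𝔗`, `ℌ`, `𝔠`. Over a field containing `ζ = ζ₇`
(`ζ⁶ + ζ⁵ + ⋯ + 1 = 0`) the cusp form splits, `𝔠 = (X - e₁)(X - e₂)(X - e₃)` with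
`e_k = 2 + 3 η_k + η_k²`, `η_k = ζ^k + ζ^{-k}` (`lvC_eq_mul`), and ONE Kummer layer of degree `7`,
`F₁ = K(v)(g)`, `g⁷ = 𝔥 = (v - e₁)(v - e₂)² (v - e₃)⁴`,
is totally ramified above the three simple poles (there `v(𝔥) ∈ {1, 2, 4}` is prime to `7`) and
unramified everywhere else (`v(𝔥) ∈ {0, -7}`), by Stichtenoth Prop. 3.7.3 in the two extreme cases of
the tree's `FunctionFieldRadicalLayerSignature` (the poles of the seed being of the two kinds, through
the even companion's `PlaceOver.ord_algebraMap_eq_of_forall_ord_neg_mixed`). Hence `𝔤 ∈ F₁` has zeros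
of order `2`, `𝔤 - 1` zeros of order `3`, poles of order `7`, and `F₁/K(𝔤)` is unramified over the
other closed points (a covering of degree `168` and genus `3`, the degree, genus and signature of Klein's
`X(7) → X(1)`); finally `K` is replaced by the full constant field of `F₁`
(`exists_fullConstantField_of_signature`).

Implementation note: as in the companions the forms are local notations with fully ascribed leaves.

## References

* D. S. Kubert, *Universal bounds on the torsion of elliptic curves*, Proc. London Math. Soc. (3) 33
  (1976) 193–237: Table 3 (Tate normal form, `b = d³ - d²`, `c = d² - d` for a point of order `7`).
* F. Klein, *Über die Transformation siebenter Ordnung der elliptischen Funktionen*, Math. Ann. 14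
  (1879) 428–471 (the covering `X(7) → X(1)` of signature `(2, 3, 7)`).
* H. Darmon, A. Granville, *On the equations `z^m = F(x, y)` and `A x^p + B y^q = C z^r`*, Bull. London
  Math. Soc. 27 (1995) 513–543: Theorem 2 (p. 515), Prop. 3.1 (p. 525). [DarmonGranville1995]
* H. Stichtenoth, *Algebraic Function Fields and Codes*, GTM 254, 2009: Prop. 3.7.3 (Kummer
  extensions), Thm. 3.1.11, Prop. 1.1.5, Cor. 1.1.20. [Stichtenoth2009]
* H. Pasten, *Shimura curves and the abc conjecture*, J. Number Theory 254 (2024) 214–335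
  (arXiv:1705.09251), §6.5, Lemma 6.10. [PastenShimura2024]
-/

noncomputable section

open scoped Classical Polynomial IntermediateField

namespace Literature.NumberTheory.DiophantineGeometry

open Polynomial

universe u v

namespace AlgFunctionField

/-! ### A. The level-`7` forms `ℌ = -c₄`, `𝔗 = -c₆`, the cusp form `𝔠` and `𝔡 = X⁷ (1 - X)⁷ 𝔠 = -Δ` -/

/-- `ℌ = -c₄(E_d) = -X⁸ + 12 X⁷ - 42 X⁶ + 56 X⁵ - 35 X⁴ + 14 X² - 4 X - 1` (the points over `j = 0`;
local notation). -/
local notation3 "ℌ(" K ")" =>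
  (-(X : Polynomial K) ^ (8 : ℕ) + (12 : Polynomial K) * (X : Polynomial K) ^ (7 : ℕ) -
    (42 : Polynomial K) * (X : Polynomial K) ^ (6 : ℕ) + (56 : Polynomial K) * (X : Polynomial K) ^ (5 : ℕ) -
    (35 : Polynomial K) * (X : Polynomial K) ^ (4 : ℕ) + (14 : Polynomial K) * (X : Polynomial K) ^ (2 : ℕ) -
    (4 : Polynomial K) * (X : Polynomial K) - (1 : Polynomial K))

/-- `𝔗 = -c₆(E_d) = X¹² - 18 X¹¹ + 117 X¹⁰ - 354 X⁹ + 570 X⁸ - 486 X⁷ + 273 X⁶ - 222 X⁵ + 174 X⁴ - 46 X³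
- 15 X² + 6 X + 1` (the points over `j = 1728`; local notation). -/
local notation3 "𝔗(" K ")" =>
  ((X : Polynomial K) ^ (12 : ℕ) - (18 : Polynomial K) * (X : Polynomial K) ^ (11 : ℕ) +
    (117 : Polynomial K) * (X : Polynomial K) ^ (10 : ℕ) - (354 : Polynomial K) * (X : Polynomial K) ^ (9 : ℕ) +
    (570 : Polynomial K) * (X : Polynomial K) ^ (8 : ℕ) - (486 : Polynomial K) * (X : Polynomial K) ^ (7 : ℕ) +
    (273 : Polynomial K) * (X : Polynomial K) ^ (6 : ℕ) - (222 : Polynomial K) * (X : Polynomial K) ^ (5 : ℕ) +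
    (174 : Polynomial K) * (X : Polynomial K) ^ (4 : ℕ) - (46 : Polynomial K) * (X : Polynomial K) ^ (3 : ℕ) -
    (15 : Polynomial K) * (X : Polynomial K) ^ (2 : ℕ) + (6 : Polynomial K) * (X : Polynomial K) +
    (1 : Polynomial K))

/-- The cusp form `𝔠 = X³ - 8 X² + 5 X + 1` (the three cusps of `X₁(7)` of width `1`; local notation). -/
local notation3 "𝔠(" K ")" =>
  ((X : Polynomial K) ^ (3 : ℕ) - (8 : Polynomial K) * (X : Polynomial K) ^ (2 : ℕ) +
    (5 : Polynomial K) * (X : Polynomial K) + (1 : Polynomial K))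

/-- `𝔡 = X⁷ (1 - X)⁷ 𝔠 = -Δ(E_d)` (the six cusps with their widths; local notation). -/
local notation3 "𝔡(" K ")" =>
  ((X : Polynomial K) ^ (7 : ℕ) * ((1 : Polynomial K) - (X : Polynomial K)) ^ (7 : ℕ) * 𝔠(K))

/-- `𝔢 = -17 X⁴ + 138 X³ - 147 X² + 26 X + 7`, the cofactor in `𝔡' = X⁶ (1 - X)⁶ 𝔢` (local notation). -/
local notation3 "𝔢(" K ")" =>
  (-(17 : Polynomial K) * (X : Polynomial K) ^ (4 : ℕ) + (138 : Polynomial K) * (X : Polynomial K) ^ (3 : ℕ) -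
    (147 : Polynomial K) * (X : Polynomial K) ^ (2 : ℕ) + (26 : Polynomial K) * (X : Polynomial K) +
    (7 : Polynomial K))

section Forms

variable {K : Type u} [Field K]

/-- `deg ℌ = 8`. [folklore] -/
theorem natDegree_lvH : (ℌ(K)).natDegree = 8 := by compute_degree!

/-- `deg 𝔗 = 12`. [folklore] -/
theorem natDegree_lvT : (𝔗(K)).natDegree = 12 := by compute_degree!

/-- `deg 𝔠 = 3`. [folklore] -/
theorem natDegree_lvC : (𝔠(K)).natDegree = 3 := by compute_degree!

/-- `𝔡 = -Δ(E_d)` expanded. [folklore] -/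
theorem lvD_eq : 𝔡(K) = -X ^ 17 + 15 * X ^ 16 - 82 * X ^ 15 + 237 * X ^ 14 - 413 * X ^ 13 + 455 * X ^ 12 -
    315 * X ^ 11 + 127 * X ^ 10 - 22 * X ^ 9 - 2 * X ^ 8 + X ^ 7 := by ring

/-- `deg 𝔡 = 17`. [folklore] -/
theorem natDegree_lvD : (𝔡(K)).natDegree = 17 := by rw [lvD_eq]; compute_degree!

/-- `ℌ, 𝔗, 𝔠, 𝔡 ≠ 0`. [folklore] -/
theorem lv_ne_zero : ℌ(K) ≠ 0 ∧ 𝔗(K) ≠ 0 ∧ 𝔠(K) ≠ 0 ∧ 𝔡(K) ≠ 0 := by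
  refine ⟨fun h => ?_, fun h => ?_, fun h => ?_, fun h => ?_⟩
  · have := natDegree_lvH (K := K); rw [h, natDegree_zero] at this; exact absurd this (by norm_num)
  · have := natDegree_lvT (K := K); rw [h, natDegree_zero] at this; exact absurd this (by norm_num)
  · have := natDegree_lvC (K := K); rw [h, natDegree_zero] at this; exact absurd this (by norm_num)
  · have := natDegree_lvD (K := K); rw [h, natDegree_zero] at this; exact absurd this (by norm_num)

/-- `ℌ(0) = -1`, `𝔗(0) = 1`, `𝔠(0) = 1`; `ℌ(1) = -1`, `𝔗(1) = 1`, `𝔠(1) = -1`. [folklore] -/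
theorem lv_eval : (ℌ(K)).eval 0 = -1 ∧ (𝔗(K)).eval 0 = 1 ∧ (𝔠(K)).eval 0 = 1 ∧
    (ℌ(K)).eval 1 = -1 ∧ (𝔗(K)).eval 1 = 1 ∧ (𝔠(K)).eval 1 = -1 := by
  refine ⟨?_, ?_, ?_, ?_, ?_, ?_⟩ <;> norm_num

/-- **The Klein-shaped identity of level `7`**: `ℌ³ + 𝔗² = 1728 𝔡`, i.e. `c₄³ - c₆² = 1728 Δ` for Tate's
normal form `E_d` of a curve with a point of order `7` (Kubert 1976, Table 3). [folklore] -/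
theorem lvH_pow_add_lvT_pow : ℌ(K) ^ 3 + 𝔗(K) ^ 2 = 1728 * 𝔡(K) := by ring

/-- The derivative of `ℌ`. [folklore] -/
theorem derivative_lvH :
    derivative ℌ(K) = -(8 * X ^ 7) + 84 * X ^ 6 - 252 * X ^ 5 + 280 * X ^ 4 - 140 * X ^ 3 + 28 * X - 4 := by
  simp only [derivative_sub, derivative_add, derivative_neg, derivative_mul, derivative_X_pow,
    derivative_X, derivative_one, derivative_ofNat, Nat.cast_ofNat, zero_mul, zero_add, map_ofNat]
  norm_num; ring

/-- The derivative of `𝔗`. [folklore] -/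
theorem derivative_lvT :
    derivative 𝔗(K) = 12 * X ^ 11 - 198 * X ^ 10 + 1170 * X ^ 9 - 3186 * X ^ 8 + 4560 * X ^ 7 -
      3402 * X ^ 6 + 1638 * X ^ 5 - 1110 * X ^ 4 + 696 * X ^ 3 - 138 * X ^ 2 - 30 * X + 6 := by
  simp only [derivative_sub, derivative_add, derivative_mul, derivative_X_pow, derivative_X,
    derivative_one, derivative_ofNat, Nat.cast_ofNat, zero_mul, zero_add, map_ofNat]
  norm_num; ring

/-- The derivative of `𝔠`. [folklore] -/
theorem derivative_lvC : derivative 𝔠(K) = 3 * X ^ 2 - 16 * X + 5 := by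
  simp only [derivative_sub, derivative_add, derivative_mul, derivative_X_pow, derivative_X,
    derivative_one, derivative_ofNat, Nat.cast_ofNat, zero_mul, zero_add, map_ofNat]
  norm_num; ring

/-- **The derivative of `𝔡`**: `𝔡' = X⁶ (1 - X)⁶ 𝔢` with `𝔢 = (7 - 14 X) 𝔠 + X (1 - X) 𝔠'`. [folklore] -/
theorem derivative_lvD : derivative 𝔡(K) = X ^ 6 * (1 - X) ^ 6 * 𝔢(K) := by
  rw [lvD_eq]
  simp only [derivative_sub, derivative_add, derivative_neg, derivative_mul, derivative_X_pow,
    derivative_ofNat, Nat.cast_ofNat, zero_mul, zero_add, map_ofNat]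
  norm_num; ring

/-- **First Wronskian identity** `2 𝔗' X (1 - X) 𝔠 - 𝔗 𝔢 = -7 ℌ²` (the derivative of `𝔗²/𝔡` vanishes
doubly at the points over `j = 0`). [folklore] -/
theorem wronskian_lvT_lvD :
    2 * derivative 𝔗(K) * (X * (1 - X) * 𝔠(K)) - 𝔗(K) * 𝔢(K) = -7 * ℌ(K) ^ 2 := by
  rw [derivative_lvT]; ring

/-- **Second Wronskian identity** `3 ℌ' X (1 - X) 𝔠 - ℌ 𝔢 = 7 𝔗` (the derivative of `ℌ³/𝔡` vanishes at
the points over `j = 1728`). [folklore] -/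
theorem wronskian_lvH_lvD :
    3 * derivative ℌ(K) * (X * (1 - X) * 𝔠(K)) - ℌ(K) * 𝔢(K) = 7 * 𝔗(K) := by
  rw [derivative_lvH]; ring

variable [CharZero K]

/-- **`ℌ` and `𝔠` are coprime**: the Bézout identity
`(444 X² - 3005 X - 1710) ℌ + (444 X⁷ - 4781 X⁶ + 12530 X⁵ - 6853 X⁴ - 693 X³ + 6776 X² - 1540 X - 1661) 𝔠 = 49`.
[folklore] -/
theorem isCoprime_lvH_lvC : IsCoprime ℌ(K) 𝔠(K) := by
  have key : (444 * X ^ 2 - 3005 * X - 1710 : K[X]) * ℌ(K) +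
      (444 * X ^ 7 - 4781 * X ^ 6 + 12530 * X ^ 5 - 6853 * X ^ 4 - 693 * X ^ 3 + 6776 * X ^ 2 -
        1540 * X - 1661) * 𝔠(K) = C (49 : K) := by
    rw [map_ofNat]; ring
  have hu : IsUnit (C (49 : K) : K[X]) := isUnit_C.mpr (by norm_num : (49 : K) ≠ 0).isUnit
  obtain ⟨i, hi⟩ := hu
  refine ⟨(↑i⁻¹ : K[X]) * (444 * X ^ 2 - 3005 * X - 1710), (↑i⁻¹ : K[X]) * (444 * X ^ 7 - 4781 * X ^ 6 +
    12530 * X ^ 5 - 6853 * X ^ 4 - 693 * X ^ 3 + 6776 * X ^ 2 - 1540 * X - 1661), ?_⟩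
  rw [mul_assoc, mul_assoc, ← mul_add, key, ← hi, Units.inv_mul]

omit [CharZero K] in
/-- `ℌ` is prime to `X` and to `1 - X` (`ℌ(0) = ℌ(1) = -1`). [folklore] -/
theorem isCoprime_lvH_X : IsCoprime ℌ(K) X ∧ IsCoprime ℌ(K) (1 - X) := by
  constructor
  · have h := ((isCoprime_one_left (x := (X : K[X]))).neg_left).add_mul_left_left
      (-X ^ 7 + 12 * X ^ 6 - 42 * X ^ 5 + 56 * X ^ 4 - 35 * X ^ 3 + 14 * X - 4)
    have e : (-1 + X * (-X ^ 7 + 12 * X ^ 6 - 42 * X ^ 5 + 56 * X ^ 4 - 35 * X ^ 3 + 14 * X - 4) : K[X]) =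
        ℌ(K) := by ring
    rwa [e] at h
  · have h := ((isCoprime_one_left (x := (1 - X : K[X]))).neg_left).add_mul_left_left
      (X ^ 7 - 11 * X ^ 6 + 31 * X ^ 5 - 25 * X ^ 4 + 10 * X ^ 3 + 10 * X ^ 2 - 4 * X)
    have e : (-1 + (1 - X) * (X ^ 7 - 11 * X ^ 6 + 31 * X ^ 5 - 25 * X ^ 4 + 10 * X ^ 3 + 10 * X ^ 2 -
        4 * X) : K[X]) = ℌ(K) := by ring
    rwa [e] at h

omit [CharZero K] in
/-- `X`, `1 - X` and `𝔠` are pairwise coprime (`𝔠(0) = 1`, `𝔠(1) = -1`). [folklore] -/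
theorem isCoprime_cusps : IsCoprime (X : K[X]) (1 - X) ∧ IsCoprime 𝔠(K) X ∧ IsCoprime 𝔠(K) (1 - X) := by
  refine ⟨⟨1, 1, by ring⟩, ?_, ?_⟩
  · have h := (isCoprime_one_left (x := (X : K[X]))).add_mul_left_left (X ^ 2 - 8 * X + 5)
    have e : (1 + X * (X ^ 2 - 8 * X + 5) : K[X]) = 𝔠(K) := by ring
    rwa [e] at h
  · have h := ((isCoprime_one_left (x := (1 - X : K[X]))).neg_left).add_mul_left_left (-X ^ 2 + 7 * X + 2)
    have e : (-1 + (1 - X) * (-X ^ 2 + 7 * X + 2) : K[X]) = 𝔠(K) := by ring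
    rwa [e] at h

/-- **`ℌ` and `𝔡` are coprime.** [folklore] -/
theorem isCoprime_lvH_lvD : IsCoprime ℌ(K) 𝔡(K) :=
  ((isCoprime_lvH_X (K := K)).1.pow_right.mul_right (isCoprime_lvH_X (K := K)).2.pow_right).mul_right
    isCoprime_lvH_lvC

/-- A non-zero natural number is a unit constant in `K[X]` (`char K = 0`; private copy of the tool of the
icosahedral companion). [folklore] -/
private theorem isUnit_C_ofNat' {n : ℕ} (hn : n ≠ 0) : IsUnit (C (n : K) : K[X]) :=
  isUnit_C.mpr (Nat.cast_ne_zero.mpr hn).isUnit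

/-- **`𝔗` is prime to `𝔡` and to `ℌ`**: a common factor of `𝔗` and `𝔡` would divide
`ℌ³ = 1728 𝔡 - 𝔗²`, and a common factor of `𝔗` and `ℌ` would divide `1728 𝔡`. [folklore] -/
theorem isCoprime_lvT : IsCoprime 𝔗(K) 𝔡(K) ∧ IsCoprime 𝔗(K) ℌ(K) := by
  obtain ⟨hH, -, -, hD⟩ := lv_ne_zero (K := K)
  have hTD : IsCoprime 𝔗(K) 𝔡(K) := by
    refine isCoprime_of_irreducible_dvd (fun h => hD h.2) fun ρ hρ hT hf => ?_
    have hH3 : ρ ∣ ℌ(K) ^ 3 := by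
      have e : ℌ(K) ^ 3 = 1728 * 𝔡(K) - 𝔗(K) ^ 2 := by rw [← lvH_pow_add_lvT_pow]; ring
      rw [e]
      exact dvd_sub (dvd_mul_of_dvd_right hf _) (hT.trans (dvd_pow_self _ two_ne_zero))
    exact hρ.not_isUnit (isCoprime_lvH_lvD.isUnit_of_dvd' (hρ.prime.dvd_of_dvd_pow hH3) hf)
  refine ⟨hTD, isCoprime_of_irreducible_dvd (fun h => hH h.2) fun ρ hρ hT hH' => ?_⟩
  have hp := hρ.prime
  have h5 : ρ ∣ C ((1728 : ℕ) : K) * 𝔡(K) := by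
    have e : C ((1728 : ℕ) : K) * 𝔡(K) = ℌ(K) ^ 3 + 𝔗(K) ^ 2 := by
      rw [lvH_pow_add_lvT_pow]; simp only [Nat.cast_ofNat, map_ofNat]
    rw [e]
    exact dvd_add (hH'.trans (dvd_pow_self _ three_ne_zero)) (hT.trans (dvd_pow_self _ two_ne_zero))
  rcases hp.dvd_or_dvd h5 with h | h
  · exact hρ.not_isUnit (isUnit_of_dvd_unit h (isUnit_C_ofNat' (by norm_num)))
  · exact hρ.not_isUnit (hTD.isUnit_of_dvd' hT h)

/-- **`𝔗`, `ℌ` and `𝔠` are separable**: a repeated factor of `𝔗` would divide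
`-7 ℌ² = 2 𝔗' X (1 - X) 𝔠 - 𝔗 𝔢`; one of `ℌ` would divide `7 𝔗 = 3 ℌ' X (1 - X) 𝔠 - ℌ 𝔢`; one of `𝔠`
would divide `𝔠` and `𝔢 = (7 - 14 X) 𝔠 + X (1 - X) 𝔠'`, hence `-7 ℌ²`, contradicting `IsCoprime ℌ 𝔠`.
[folklore] -/
theorem separable_lv : (𝔗(K)).Separable ∧ (ℌ(K)).Separable ∧ (𝔠(K)).Separable := by
  obtain ⟨hH, hT, hC, -⟩ := lv_ne_zero (K := K)
  obtain ⟨-, hTH⟩ := isCoprime_lvT (K := K)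
  have h7 : IsUnit (C ((7 : ℕ) : K) : K[X]) := isUnit_C_ofNat' (K := K) (by norm_num)
  have eW : -(C ((7 : ℕ) : K)) * ℌ(K) ^ 2 = 2 * derivative 𝔗(K) * (X * (1 - X) * 𝔠(K)) - 𝔗(K) * 𝔢(K) := by
    rw [wronskian_lvT_lvD]; simp only [Nat.cast_ofNat, map_ofNat, neg_mul]
  refine ⟨?_, ?_, ?_⟩
  · rw [separable_def]
    refine isCoprime_of_irreducible_dvd (fun h => hT h.1) fun ρ hρ h1 h2 => ?_
    have hp := hρ.prime
    have h5 : ρ ∣ -(C ((7 : ℕ) : K)) * ℌ(K) ^ 2 := by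
      rw [eW]
      exact dvd_sub (dvd_mul_of_dvd_left (dvd_mul_of_dvd_right h2 _) _) (dvd_mul_of_dvd_left h1 _)
    rcases hp.dvd_or_dvd h5 with h | h
    · exact hρ.not_isUnit (isUnit_of_dvd_unit h h7.neg)
    · exact hρ.not_isUnit (hTH.isUnit_of_dvd' h1 (hp.dvd_of_dvd_pow h))
  · rw [separable_def]
    refine isCoprime_of_irreducible_dvd (fun h => hH h.1) fun ρ hρ h1 h2 => ?_
    have hp := hρ.prime
    have h5 : ρ ∣ C ((7 : ℕ) : K) * 𝔗(K) := by
      have e : C ((7 : ℕ) : K) * 𝔗(K) = 3 * derivative ℌ(K) * (X * (1 - X) * 𝔠(K)) - ℌ(K) * 𝔢(K) := by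
        rw [wronskian_lvH_lvD]; simp only [Nat.cast_ofNat, map_ofNat]
      rw [e]
      exact dvd_sub (dvd_mul_of_dvd_left (dvd_mul_of_dvd_right h2 _) _) (dvd_mul_of_dvd_left h1 _)
    rcases hp.dvd_or_dvd h5 with h | h
    · exact hρ.not_isUnit (isUnit_of_dvd_unit h h7)
    · exact hρ.not_isUnit (hTH.isUnit_of_dvd' h h1)
  · rw [separable_def]
    refine isCoprime_of_irreducible_dvd (fun h => hC h.1) fun ρ hρ h1 h2 => ?_
    have hp := hρ.prime
    have hE : ρ ∣ 𝔢(K) := by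
      have e : 𝔢(K) = (7 - 14 * X) * 𝔠(K) + X * (1 - X) * derivative 𝔠(K) := by
        rw [derivative_lvC]; ring
      rw [e]
      exact dvd_add (dvd_mul_of_dvd_right h1 _) (dvd_mul_of_dvd_right h2 _)
    have h5 : ρ ∣ -(C ((7 : ℕ) : K)) * ℌ(K) ^ 2 := by
      rw [eW]
      exact dvd_sub (dvd_mul_of_dvd_right (dvd_mul_of_dvd_right h1 _) _) (dvd_mul_of_dvd_right hE _)
    rcases hp.dvd_or_dvd h5 with h | h
    · exact hρ.not_isUnit (isUnit_of_dvd_unit h h7.neg)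
    · exact hρ.not_isUnit (isCoprime_lvH_lvC.isUnit_of_dvd' (hp.dvd_of_dvd_pow h) h1)

omit [CharZero K] in
/-- `(T²)'(c D) - T² (c D)' = c T (2 T' D - T D')`. [folklore] -/
theorem wronskian_sq_mul (T D : K[X]) (c : K) :
    derivative (T ^ 2) * (C c * D) - T ^ 2 * derivative (C c * D) =
      C c * T * (2 * derivative T * D - T * derivative D) := by
  simp only [derivative_pow, derivative_mul, derivative_C, zero_mul, zero_add, Nat.cast_ofNat,
    Nat.add_one_sub_one, map_ofNat]
  ring

omit [CharZero K] in
/-- **The Wronskian of `A = 𝔗²` and `B = 1728 𝔡`**: `A'B - AB' = 1728 𝔗 · X⁶ (1 - X)⁶ · (-7 ℌ²)`. [folklore] -/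
theorem wronskian_lv :
    derivative (𝔗(K) ^ 2) * (C (1728 : K) * 𝔡(K)) - 𝔗(K) ^ 2 * derivative (C (1728 : K) * 𝔡(K)) =
      C (1728 : K) * 𝔗(K) * (X ^ 6 * (1 - X) ^ 6) * (-7 * ℌ(K) ^ 2) := by
  rw [wronskian_sq_mul, derivative_lvD, ← wronskian_lvT_lvD]; ring

omit [CharZero K] in
/-- The radicand form `(X - e₁)(X - e₂)²(X - e₃)⁴` has degree `7` and is non-zero. [folklore] -/
theorem natDegree_radicand (e₁ e₂ e₃ : K) :
    ((X - C e₁) * (X - C e₂) ^ 2 * (X - C e₃) ^ 4 : K[X]).natDegree = 7 ∧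
      ((X - C e₁) * (X - C e₂) ^ 2 * (X - C e₃) ^ 4 : K[X]) ≠ 0 := by
  have h1 : (X - C e₁ : K[X]) ≠ 0 := X_sub_C_ne_zero e₁
  have h2 : ((X - C e₂) ^ 2 : K[X]) ≠ 0 := pow_ne_zero _ (X_sub_C_ne_zero e₂)
  have h3 : ((X - C e₃) ^ 4 : K[X]) ≠ 0 := pow_ne_zero _ (X_sub_C_ne_zero e₃)
  refine ⟨?_, mul_ne_zero (mul_ne_zero h1 h2) h3⟩
  rw [natDegree_mul (mul_ne_zero h1 h2) h3, natDegree_mul h1 h2, natDegree_pow, natDegree_pow,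
    natDegree_X_sub_C, natDegree_X_sub_C, natDegree_X_sub_C]

omit [CharZero K] in
/-- `1 - X` is separable (its derivative `-1` is a unit). [folklore] -/
theorem separable_one_sub_X : (1 - X : K[X]).Separable := by
  rw [separable_def, derivative_sub, derivative_one, derivative_X, zero_sub]
  exact ⟨0, -1, by ring⟩

end Forms

/-! ### B. The seed `𝔤 = 𝔗(v)²/(1728 𝔡(v)) = 1 - j/1728` on the line `K(v) = K(X₁(7))` -/

/-- `𝔗(v)`, `ℌ(v)`, `𝔠(v)`, `𝔡(v)` on the line `K(v)` (local notations). -/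
local notation3 "𝔗ᵥ(" K ")" => (aeval (RatFunc.X : RatFunc K) 𝔗(K))
local notation3 "ℌᵥ(" K ")" => (aeval (RatFunc.X : RatFunc K) ℌ(K))
local notation3 "𝔠ᵥ(" K ")" => (aeval (RatFunc.X : RatFunc K) 𝔠(K))
local notation3 "𝔡ᵥ(" K ")" => (aeval (RatFunc.X : RatFunc K) 𝔡(K))

/-- The seed `𝔤 = 𝔗(v)²/(1728 𝔡(v)) = 1 - j(E_v)/1728`, the `j`-map of `X₁(7)` normalised to
`0 ↦ (2)`, `1 ↦ (3)`, `∞ ↦ (7, 1)` (local notation). -/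
local notation3 "𝔤(" K ")" =>
  ((𝔗ᵥ(K)) ^ (2 : ℕ) / (algebraMap K (RatFunc K) (1728 : K) * (𝔡ᵥ(K))) : RatFunc K)

/-- The radicand `𝔥 = (v - e₁)(v - e₂)²(v - e₃)⁴` of the Kummer layer (local notation). -/
local notation3 "𝔥(" K ", " a ", " b ", " c ")" =>
  (aeval (RatFunc.X : RatFunc K) (((X : Polynomial K) - C a) * ((X : Polynomial K) - C b) ^ (2 : ℕ) *
    ((X : Polynomial K) - C c) ^ (4 : ℕ)))

section Seed

variable {K : Type u} [Field K]

/-- Non-vanishing on the line: `𝔗(v)`, `ℌ(v)`, `𝔠(v)`, `𝔡(v)`, `𝔥`. [folklore] -/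
theorem seedS_ne_zero (e₁ e₂ e₃ : K) :
    𝔗ᵥ(K) ≠ 0 ∧ ℌᵥ(K) ≠ 0 ∧ 𝔠ᵥ(K) ≠ 0 ∧ 𝔡ᵥ(K) ≠ 0 ∧ 𝔥(K, e₁, e₂, e₃) ≠ 0 := by
  obtain ⟨hH, hT, hC, hD⟩ := lv_ne_zero (K := K)
  obtain ⟨-, hh⟩ := natDegree_radicand (K := K) e₁ e₂ e₃
  exact ⟨aeval_ratFunc_X_ne_zero hT, aeval_ratFunc_X_ne_zero hH, aeval_ratFunc_X_ne_zero hC,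
    aeval_ratFunc_X_ne_zero hD, aeval_ratFunc_X_ne_zero hh⟩

/-- `𝔤 = A(v)/B(v)` with `A = 𝔗²`, `B = 1728 𝔡`. [folklore] -/
theorem seedS_eq_div :
    𝔤(K) = aeval (RatFunc.X : RatFunc K) (𝔗(K) ^ 2) /
      aeval (RatFunc.X : RatFunc K) (C (1728 : K) * 𝔡(K)) := by
  rw [map_pow, map_mul (aeval RatFunc.X) (C (1728 : K)), aeval_C]

variable [CharZero K]

omit [CharZero K] in
/-- **The Klein-shaped identity on the line**: `ℌ(v)³ + 𝔗(v)² = 1728 𝔡(v)`. [folklore] -/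
theorem seedS_klein : ℌᵥ(K) ^ 3 + 𝔗ᵥ(K) ^ 2 = algebraMap K (RatFunc K) 1728 * 𝔡ᵥ(K) := by
  have h := congr_arg (aeval (RatFunc.X : RatFunc K)) (lvH_pow_add_lvT_pow (K := K))
  rw [map_add, map_pow, map_pow, show (1728 : K[X]) = C (1728 : K) by rw [map_ofNat],
    map_mul (aeval RatFunc.X) (C (1728 : K)), aeval_C] at h
  exact h

/-- **`𝔤 - 1 = -ℌ(v)³/(1728 𝔡(v))`** (the Klein-shaped identity). [folklore] -/
theorem seedS_sub_one :
    𝔤(K) - 1 = -(ℌᵥ(K) ^ 3) / (algebraMap K (RatFunc K) 1728 * (𝔡ᵥ(K))) := by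
  obtain ⟨-, -, -, hD, -⟩ := seedS_ne_zero (K := K) 0 0 0
  have h1728 : algebraMap K (RatFunc K) 1728 ≠ 0 := (_root_.map_ne_zero _).2 (by norm_num)
  rw [div_sub_one (mul_ne_zero h1728 hD)]
  congr 1
  rw [← seedS_klein]; ring

/-- **The order of the seed**: `v(𝔤) = 2 v(𝔗(v)) - v(𝔡(v))`. [folklore] -/
theorem ord_seedS (P : PlaceOver K (RatFunc K)) :
    P.ord 𝔤(K) = 2 * P.ord 𝔗ᵥ(K) - P.ord 𝔡ᵥ(K) := by
  obtain ⟨hT, -, -, hD, -⟩ := seedS_ne_zero (K := K) 0 0 0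
  obtain ⟨h1728, ho⟩ := seedI_const (K := K) P
  rw [P.ord_div (pow_ne_zero _ hT) (mul_ne_zero h1728 hD), P.ord_pow hT, P.ord_mul_eq h1728 hD, ho]
  push_cast; ring

/-- **The order of `𝔤 - 1`**: `v(𝔤 - 1) = 3 v(ℌ(v)) - v(𝔡(v))`. [folklore] -/
theorem ord_seedS_sub_one (P : PlaceOver K (RatFunc K)) :
    P.ord (𝔤(K) - 1) = 3 * P.ord ℌᵥ(K) - P.ord 𝔡ᵥ(K) := by
  obtain ⟨-, hH, -, hD, -⟩ := seedS_ne_zero (K := K) 0 0 0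
  obtain ⟨h1728, ho⟩ := seedI_const (K := K) P
  rw [seedS_sub_one, P.ord_div (neg_ne_zero.mpr (pow_ne_zero _ hH)) (mul_ne_zero h1728 hD), P.ord_neg,
    P.ord_pow hH, P.ord_mul_eq h1728 hD, ho]
  push_cast; ring

omit [CharZero K] in
/-- Splitting `a + b + c = 1` for `a, b, c ≥ 0` (kept outside the big case analysis so that `omega`
sees a small context). [folklore] -/
private theorem aux_split3 {a b c : ℤ} (ha : 0 ≤ a) (hb : 0 ≤ b) (hc : 0 ≤ c) (h : a + b + c = 1) :
    (a = 1 ∧ b = 0 ∧ c = 0) ∨ (a = 0 ∧ b = 1 ∧ c = 0) ∨ (a = 0 ∧ b = 0 ∧ c = 1) := by omega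

omit [CharZero K] in
/-- `a + b + c = 0` for `a, b, c ≥ 0` forces `a = b = c = 0`. [folklore] -/
private theorem aux_zero3 {a b c : ℤ} (ha : 0 ≤ a) (hb : 0 ≤ b) (hc : 0 ≤ c) (h : a + b + c = 0) :
    a = 0 ∧ b = 0 ∧ c = 0 := by omega

omit [CharZero K] in
/-- `7a + 7b + c = 0` for `a, b, c ≥ 0` forces `a = b = c = 0`. [folklore] -/
private theorem aux_zero7 {a b c : ℤ} (ha : 0 ≤ a) (hb : 0 ≤ b) (hc : 0 ≤ c) (h : 7 * a + 7 * b + c = 0) :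
    a = 0 ∧ b = 0 ∧ c = 0 := by omega

omit [CharZero K] in
/-- `7a + 7b + 0 > 0`, `a, b ≥ 0`, not both positive: `(a, b) = (1, 0)` or `a = 0 < b`. [folklore] -/
private theorem aux_pos7 {a b d : ℤ} (ha : 0 ≤ a) (hb : 0 ≤ b) (hd : d = 7 * a + 7 * b + 0) (hpos : 0 < d)
    (hex : ¬ (0 < a ∧ 0 < b)) : (0 < a ∧ b = 0) ∨ (a = 0 ∧ 0 < b) := by omega

/-- **The five kinds of places of the line for the level-`7` seed.** At every place `P` of `K(v)` (with
`𝔠 = (X - e₁)(X - e₂)(X - e₃)`, `𝔥 = (v - e₁)(v - e₂)²(v - e₃)⁴`) one of: (poles) `v(𝔤 - 1) = v(𝔤) < 0`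
and either `v(𝔤) = -7`, `7 ∣ v(𝔥)` (the cusps `v = ∞, 0, 1` of width `7`: `v(𝔥) = -7, 0, 0`) or
`v(𝔤) = -1`, `v(𝔥) ∈ {1, 2, 4}` prime to `7` (the cusps `𝔠(v) = 0` of width `1`), with
`v(π₀(𝔤)) = deg π₀ · v(𝔤)`; (zeros: `𝔗(v) = 0`) `v(𝔤) = 2`, `v(𝔤 - 1) = 0`, `v(𝔥) = 0`;
(ones: `ℌ(v) = 0`) `v(𝔤) = 0`, `v(𝔤 - 1) = 3`, `v(𝔥) = 0`; (generic) `v ∈ 𝒪_P`, `𝔡(v)` unit,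
`v(𝔤) = v(𝔤 - 1) = 0`, `v(𝔥) = 0`. [folklore] -/
theorem seedS_cases {e₁ e₂ e₃ : K} (he : 𝔠(K) = (X - C e₁) * (X - C e₂) * (X - C e₃))
    (P : PlaceOver K (RatFunc K)) :
    (P.ord 𝔤(K) < 0 ∧ P.ord (𝔤(K) - 1) = P.ord 𝔤(K) ∧
        ((P.ord 𝔤(K) = -7 ∧ (7 : ℤ) ∣ P.ord 𝔥(K, e₁, e₂, e₃)) ∨
          (P.ord 𝔤(K) = -1 ∧ IsCoprime (P.ord 𝔥(K, e₁, e₂, e₃)) 7)) ∧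
        ∀ π₀ : K[X], π₀ ≠ 0 → P.ord (aeval 𝔤(K) π₀) = π₀.natDegree * P.ord 𝔤(K)) ∨
      (P.ord 𝔤(K) = 2 ∧ P.ord (𝔤(K) - 1) = 0 ∧ P.ord 𝔥(K, e₁, e₂, e₃) = 0 ∧
        ∀ π₀ : K[X], π₀.eval 0 ≠ 0 → P.ord (aeval 𝔤(K) π₀) = 0) ∨
      (P.ord 𝔤(K) = 0 ∧ P.ord (𝔤(K) - 1) = 3 ∧ P.ord 𝔥(K, e₁, e₂, e₃) = 0 ∧
        ∀ π₀ : K[X], π₀.eval 1 ≠ 0 → P.ord (aeval 𝔤(K) π₀) = 0) ∨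
      ((RatFunc.X : RatFunc K) ∈ P.toValuationSubring ∧ P.ord 𝔡ᵥ(K) = 0 ∧ P.ord 𝔤(K) = 0 ∧
        P.ord (𝔤(K) - 1) = 0 ∧ P.ord 𝔥(K, e₁, e₂, e₃) = 0) := by
  have hut := RatFunc.transcendental_X (K := K)
  have hu1 := finrank_adjoin_ratFunc_X (K := K)
  obtain ⟨hH0, hT0, hC0, hD0⟩ := lv_ne_zero (K := K)
  obtain ⟨hd7, hh7⟩ := natDegree_radicand (K := K) e₁ e₂ e₃
  obtain ⟨hT, hH, hC, hD, hh⟩ := seedS_ne_zero (K := K) e₁ e₂ e₃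
  have hv0 : (RatFunc.X : RatFunc K) ≠ 0 := RatFunc.X_ne_zero
  have hordg := ord_seedS (K := K) P
  have hordg1 := ord_seedS_sub_one (K := K) P
  rcases lt_or_ge (P.ord (RatFunc.X : RatFunc K)) 0 with hneg | hge
  · -- (∞): the cusp `v = ∞` of width `7`
    left
    have hvm1 : P.ord (RatFunc.X : RatFunc K) = -1 := P.ord_eq_neg_one_of_finrank_eq_one hut hu1 hneg
    have hoT : P.ord 𝔗ᵥ(K) = -12 := by
      rw [(P.ord_aeval_of_ord_neg hneg hT0).2, natDegree_lvT, hvm1]; norm_num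
    have hoH : P.ord ℌᵥ(K) = -8 := by
      rw [(P.ord_aeval_of_ord_neg hneg hH0).2, natDegree_lvH, hvm1]; norm_num
    have hoD : P.ord 𝔡ᵥ(K) = -17 := by
      rw [(P.ord_aeval_of_ord_neg hneg hD0).2, natDegree_lvD, hvm1]; norm_num
    have hoh : P.ord 𝔥(K, e₁, e₂, e₃) = -7 := by
      rw [(P.ord_aeval_of_ord_neg hneg hh7).2, hd7, hvm1]; norm_num
    have hg : P.ord 𝔤(K) = -7 := by rw [hordg, hoT, hoD]; norm_num
    refine ⟨by rw [hg]; norm_num, by rw [hordg1, hg, hoH, hoD]; norm_num,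
      Or.inl ⟨hg, by rw [hoh]; norm_num⟩, fun π₀ hπ => ?_⟩
    exact (P.ord_aeval_of_ord_neg (by rw [hg]; norm_num) hπ).2
  · -- `v ∈ 𝒪_P`
    have hvO : (RatFunc.X : RatFunc K) ∈ P.toValuationSubring :=
      (P.mem_toValuationSubring_iff_ord_nonneg hv0).2 hge
    -- the linear factors `w = 1 - v`, `𝔩ᵢ = v - eᵢ`
    set w : RatFunc K := aeval (RatFunc.X : RatFunc K) ((1 : K[X]) - X) with hw
    set l₁ : RatFunc K := aeval (RatFunc.X : RatFunc K) (X - C e₁) with hl₁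
    set l₂ : RatFunc K := aeval (RatFunc.X : RatFunc K) (X - C e₂) with hl₂
    set l₃ : RatFunc K := aeval (RatFunc.X : RatFunc K) (X - C e₃) with hl₃
    have hw0 : w ≠ 0 := aeval_ratFunc_X_ne_zero (by
      intro h; have h1 := congr_arg (eval 0) h; norm_num at h1)
    have hl10 : l₁ ≠ 0 := aeval_ratFunc_X_ne_zero (X_sub_C_ne_zero e₁)
    have hl20 : l₂ ≠ 0 := aeval_ratFunc_X_ne_zero (X_sub_C_ne_zero e₂)
    have hl30 : l₃ ≠ 0 := aeval_ratFunc_X_ne_zero (X_sub_C_ne_zero e₃)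
    have hnnT : 0 ≤ P.ord 𝔗ᵥ(K) := P.ord_nonneg_of_mem (P.aeval_mem hvO _)
    have hnnH : 0 ≤ P.ord ℌᵥ(K) := P.ord_nonneg_of_mem (P.aeval_mem hvO _)
    have hnnC : 0 ≤ P.ord 𝔠ᵥ(K) := P.ord_nonneg_of_mem (P.aeval_mem hvO _)
    have hnnD : 0 ≤ P.ord 𝔡ᵥ(K) := P.ord_nonneg_of_mem (P.aeval_mem hvO _)
    have hnnw : 0 ≤ P.ord w := P.ord_nonneg_of_mem (P.aeval_mem hvO _)
    have hnn1 : 0 ≤ P.ord l₁ := P.ord_nonneg_of_mem (P.aeval_mem hvO _)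
    have hnn2 : 0 ≤ P.ord l₂ := P.ord_nonneg_of_mem (P.aeval_mem hvO _)
    have hnn3 : 0 ≤ P.ord l₃ := P.ord_nonneg_of_mem (P.aeval_mem hvO _)
    -- `𝔡(v) = v⁷ w⁷ 𝔠(v)`, `𝔠(v) = l₁ l₂ l₃`, `𝔥 = l₁ l₂² l₃⁴`
    have hordD : P.ord 𝔡ᵥ(K) = 7 * P.ord (RatFunc.X : RatFunc K) + 7 * P.ord w + P.ord 𝔠ᵥ(K) := by
      have e : 𝔡ᵥ(K) = (RatFunc.X : RatFunc K) ^ 7 * w ^ 7 * 𝔠ᵥ(K) := by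
        rw [hw, map_mul, map_mul, map_pow, map_pow, aeval_X]
      rw [e, P.ord_mul_eq (mul_ne_zero (pow_ne_zero _ hv0) (pow_ne_zero _ hw0)) hC,
        P.ord_mul_eq (pow_ne_zero _ hv0) (pow_ne_zero _ hw0), P.ord_pow hv0, P.ord_pow hw0]
      push_cast; ring
    have hordC : P.ord 𝔠ᵥ(K) = P.ord l₁ + P.ord l₂ + P.ord l₃ := by
      have e : 𝔠ᵥ(K) = l₁ * l₂ * l₃ := by rw [he, map_mul, map_mul]
      rw [e, P.ord_mul_eq (mul_ne_zero hl10 hl20) hl30, P.ord_mul_eq hl10 hl20]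
    have hordh : P.ord 𝔥(K, e₁, e₂, e₃) = P.ord l₁ + 2 * P.ord l₂ + 4 * P.ord l₃ := by
      have e : 𝔥(K, e₁, e₂, e₃) = l₁ * l₂ ^ 2 * l₃ ^ 4 := by rw [map_mul, map_mul, map_pow, map_pow]
      rw [e, P.ord_mul_eq (mul_ne_zero hl10 (pow_ne_zero _ hl20)) (pow_ne_zero _ hl30),
        P.ord_mul_eq hl10 (pow_ne_zero _ hl20), P.ord_pow hl20, P.ord_pow hl30]
      push_cast; ring
    -- at most one of two coprime forms vanishes at `P`
    have hexTD := P.not_and_ord_aeval_pos_of_isCoprime hvO (isCoprime_lvT (K := K)).1 hT hD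
    have hexHD := P.not_and_ord_aeval_pos_of_isCoprime hvO (isCoprime_lvH_lvD (K := K)) hH hD
    have hexTH := P.not_and_ord_aeval_pos_of_isCoprime hvO (isCoprime_lvT (K := K)).2 hT hH
    obtain ⟨hcXw, hcCX, hcCw⟩ := isCoprime_cusps (K := K)
    have hexXw : ¬ (0 < P.ord (RatFunc.X : RatFunc K) ∧ 0 < P.ord w) := by
      have h := P.not_and_ord_aeval_pos_of_isCoprime hvO hcXw (by rwa [aeval_X]) hw0
      rwa [aeval_X] at h
    have hexCX : ¬ (0 < P.ord 𝔠ᵥ(K) ∧ 0 < P.ord (RatFunc.X : RatFunc K)) := by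
      have h := P.not_and_ord_aeval_pos_of_isCoprime hvO hcCX hC (by rwa [aeval_X])
      rwa [aeval_X] at h
    have hexCw : ¬ (0 < P.ord 𝔠ᵥ(K) ∧ 0 < P.ord w) :=
      P.not_and_ord_aeval_pos_of_isCoprime hvO hcCw hC hw0
    rcases hnnD.lt_or_eq with hDpos | hDz
    · -- poles at finite distance: the cusps `v = 0`, `v = 1`, `𝔠(v) = 0`
      left
      have hTz : P.ord 𝔗ᵥ(K) = 0 := by
        rcases hnnT.lt_or_eq with h | h
        · exact (hexTD ⟨h, hDpos⟩).elim
        · exact h.symm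
      have hHz : P.ord ℌᵥ(K) = 0 := by
        rcases hnnH.lt_or_eq with h | h
        · exact (hexHD ⟨h, hDpos⟩).elim
        · exact h.symm
      have hgeq : P.ord 𝔤(K) = -P.ord 𝔡ᵥ(K) := by rw [hordg, hTz]; ring
      have hg1eq : P.ord (𝔤(K) - 1) = -P.ord 𝔡ᵥ(K) := by rw [hordg1, hHz]; ring
      refine ⟨by rw [hgeq]; exact neg_neg_of_pos hDpos, by rw [hg1eq, hgeq], ?_,
        fun π₀ hπ => (P.ord_aeval_of_ord_neg (by rw [hgeq]; exact neg_neg_of_pos hDpos) hπ).2⟩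
      rcases hnnC.lt_or_eq with hCpos | hCz
      · -- the cusps `𝔠(v) = 0` of width `1`
        right
        have hC1 : P.ord 𝔠ᵥ(K) = 1 :=
          P.ord_aeval_eq_one_of_separable_of_finrank_eq_one hut hu1 (separable_lv (K := K)).2.2 hCpos
        have hvz : P.ord (RatFunc.X : RatFunc K) = 0 := by
          rcases hge.lt_or_eq with h | h
          · exact (hexCX ⟨hCpos, h⟩).elim
          · exact h.symm
        have hwz : P.ord w = 0 := by
          rcases hnnw.lt_or_eq with h | h
          · exact (hexCw ⟨hCpos, h⟩).elim
          · exact h.symm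
        have hD1 : P.ord 𝔡ᵥ(K) = 1 := by rw [hordD, hvz, hwz, hC1]; norm_num
        refine ⟨by rw [hgeq, hD1], ?_⟩
        rcases aux_split3 hnn1 hnn2 hnn3 (hordC.symm.trans hC1) with ⟨ha, hb, hc⟩ | ⟨ha, hb, hc⟩ | ⟨ha, hb, hc⟩
        · rw [hordh, ha, hb, hc]; norm_num
        · rw [hordh, ha, hb, hc]; norm_num
        · rw [hordh, ha, hb, hc]; norm_num
      · -- the cusps `v = 0`, `v = 1` of width `7`
        left
        obtain ⟨h1z, h2z, h3z⟩ := aux_zero3 hnn1 hnn2 hnn3 (hordC.symm.trans hCz.symm)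
        have hhz : P.ord 𝔥(K, e₁, e₂, e₃) = 0 := by rw [hordh, h1z, h2z, h3z]; norm_num
        rw [← hCz] at hordD
        have hD7 : P.ord 𝔡ᵥ(K) = 7 := by
          rcases aux_pos7 hge hnnw hordD hDpos hexXw with ⟨hvpos, hwz⟩ | ⟨hvz, hwpos⟩
          · rw [hordD, PlaceOver.ord_eq_one_of_finrank_eq_one hut hu1 P hvpos, hwz]; norm_num
          · have hw1 : P.ord w = 1 :=
              P.ord_aeval_eq_one_of_separable_of_finrank_eq_one hut hu1 (separable_one_sub_X (K := K)) hwpos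
            rw [hordD, hvz, hw1]; norm_num
        exact ⟨by rw [hgeq, hD7], by rw [hhz]; exact dvd_zero 7⟩
    -- `𝔡(v)` a unit: `v`, `w`, `𝔠(v)`, `lᵢ` units, `𝔥` unit
    have hDz' : P.ord 𝔡ᵥ(K) = 0 := hDz.symm
    obtain ⟨hvz, hwz, hCz⟩ := aux_zero7 hge hnnw hnnC (hordD.symm.trans hDz')
    obtain ⟨h1z, h2z, h3z⟩ := aux_zero3 hnn1 hnn2 hnn3 (hordC.symm.trans hCz)
    have hhz : P.ord 𝔥(K, e₁, e₂, e₃) = 0 := by rw [hordh, h1z, h2z, h3z]; norm_num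
    rcases hnnT.lt_or_eq with hTpos | hTz
    · -- zeros: `𝔗(v) = 0`, the points over `j = 1728`
      right; left
      have hHz : P.ord ℌᵥ(K) = 0 := by
        rcases hnnH.lt_or_eq with h | h
        · exact (hexTH ⟨hTpos, h⟩).elim
        · exact h.symm
      have hT1 : P.ord 𝔗ᵥ(K) = 1 :=
        P.ord_aeval_eq_one_of_separable_of_finrank_eq_one hut hu1 (separable_lv (K := K)).1 hTpos
      have hg : P.ord 𝔤(K) = 2 := by rw [hordg, hT1, hDz']; norm_num
      refine ⟨hg, by rw [hordg1, hHz, hDz']; norm_num, hhz, fun π₀ h0 => ?_⟩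
      exact (P.ord_aeval_eq_zero_of_eval_ne_zero (by rw [hg]; norm_num) h0).2
    rcases hnnH.lt_or_eq with hHpos | hHz
    · -- ones: `ℌ(v) = 0`, the points over `j = 0`
      right; right; left
      have hH1 : P.ord ℌᵥ(K) = 1 :=
        P.ord_aeval_eq_one_of_separable_of_finrank_eq_one hut hu1 (separable_lv (K := K)).2.1 hHpos
      have hg1 : P.ord (𝔤(K) - 1) = 3 := by rw [hordg1, hH1, hDz']; norm_num
      refine ⟨by rw [hordg, ← hTz, hDz']; norm_num, hg1, hhz, fun π₀ h1 => ?_⟩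
      exact ord_aeval_eq_zero_of_ord_sub_one_pos P (by rw [hg1]; norm_num) h1
    · -- generic
      right; right; right
      exact ⟨hvO, hDz', by rw [hordg, ← hTz, hDz']; norm_num, by rw [hordg1, ← hHz, hDz']; norm_num, hhz⟩

/-- **The seed is non-zero, has a pole (at `v = 0`), hence is transcendental over `K` and is not
annihilated by a non-zero polynomial.** [cite: Stichtenoth2009, Prop. 1.1.5(c), Cor. 1.1.20] -/
theorem seedS_transcendental :
    𝔤(K) ≠ 0 ∧ Transcendental K 𝔤(K) ∧ ∀ π₀ : K[X], π₀ ≠ 0 → aeval 𝔤(K) π₀ ≠ 0 := by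
  have hut := RatFunc.transcendental_X (K := K)
  obtain ⟨hT, -, -, hD, -⟩ := seedS_ne_zero (K := K) 0 0 0
  obtain ⟨-, heT, -⟩ := lv_eval (K := K)
  have h1728 : algebraMap K (RatFunc K) 1728 ≠ 0 := (_root_.map_ne_zero _).2 (by norm_num)
  have hg0 : 𝔤(K) ≠ 0 := div_ne_zero (pow_ne_zero _ hT) (mul_ne_zero h1728 hD)
  obtain ⟨P, hP⟩ := exists_ord_pos_of_transcendental hut
  have hoT : P.ord 𝔗ᵥ(K) = 0 :=
    (P.ord_aeval_eq_zero_of_eval_ne_zero hP (p := 𝔗(K)) (by rw [heT]; exact one_ne_zero)).2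
  -- `𝔡 = X⁷ · 𝔯`, `𝔯(0) = 1`
  have hr0 : (((1 : K[X]) - X) ^ 7 * 𝔠(K)).eval 0 ≠ 0 := by norm_num
  have hR : aeval (RatFunc.X : RatFunc K) (((1 : K[X]) - X) ^ 7 * 𝔠(K)) ≠ 0 :=
    aeval_ratFunc_X_ne_zero fun h => hr0 (by rw [h, eval_zero])
  have hoR : P.ord (aeval (RatFunc.X : RatFunc K) (((1 : K[X]) - X) ^ 7 * 𝔠(K))) = 0 :=
    (P.ord_aeval_eq_zero_of_eval_ne_zero hP hr0).2
  have hoD : P.ord 𝔡ᵥ(K) = 7 * P.ord (RatFunc.X : RatFunc K) := by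
    have e : 𝔡ᵥ(K) = (RatFunc.X : RatFunc K) ^ 7 *
        aeval (RatFunc.X : RatFunc K) (((1 : K[X]) - X) ^ 7 * 𝔠(K)) := by
      rw [show 𝔡(K) = X ^ 7 * (((1 : K[X]) - X) ^ 7 * 𝔠(K)) by ring, map_mul, map_pow, aeval_X]
    rw [e, P.ord_mul_eq (pow_ne_zero _ RatFunc.X_ne_zero) hR, P.ord_pow RatFunc.X_ne_zero, hoR, add_zero]
    push_cast; ring
  have hpole : P.ord 𝔤(K) < 0 := by
    rw [ord_seedS, hoT, hoD]; omega
  have htr : Transcendental K 𝔤(K) := by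
    intro halg
    have hmem := IsAlgFunctionField.mem_valuationSubring_of_isAlgebraic P.toValuationSubring
      P.algebraMap_mem halg
    have := (P.mem_toValuationSubring_iff_ord_nonneg hg0).1 hmem
    omega
  exact ⟨hg0, htr, fun π₀ hπ h => htr ⟨π₀, hπ, h⟩⟩

/-- **The other closed points are unramified for the level-`7` seed.** For `π₀` monic irreducible,
`π₀ ∉ {X, X - 1}`, at every zero `P` of `π₀(𝔤)` on the line: `v_P(π₀(𝔤)) = 1` and `𝔥` is a unit. The
place is generic (`seedS_cases`), and there `v_P(π₀(𝔤)) = v_P(Ñ(v))` for the homogenised pull-back of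
`π₀` under `A/B = 𝔗²/(1728 𝔡)`, separable by `pullback_separable`: `A`, `B` are coprime, the Wronskian
is `1728 𝔗 · X⁶ (1 - X)⁶ · (-7 ℌ²)` (`wronskian_lv`), `A - B = -ℌ³`. [folklore] -/
theorem seedS_elsewhere {e₁ e₂ e₃ : K} (he : 𝔠(K) = (X - C e₁) * (X - C e₂) * (X - C e₃))
    {π₀ : K[X]} (hπi : Irreducible π₀) (hπm : π₀.Monic) (hπX : π₀ ≠ X) (hπX1 : π₀ ≠ X - 1)
    (P : PlaceOver K (RatFunc K)) (hP : 0 < P.ord (aeval 𝔤(K) π₀)) :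
    P.ord (aeval 𝔤(K) π₀) = 1 ∧ P.ord 𝔥(K, e₁, e₂, e₃) = 0 := by
  have hut := RatFunc.transcendental_X (K := K)
  have hu1 := finrank_adjoin_ratFunc_X (K := K)
  have h0 : π₀.eval 0 ≠ 0 := fun h0 => hπX (by
    have h := PlaceOver.eq_X_sub_C_of_irreducible_of_eval_eq_zero hπi hπm h0
    rwa [map_zero, sub_zero] at h)
  have h1 : π₀.eval 1 ≠ 0 := fun h1 => hπX1 (by
    have h := PlaceOver.eq_X_sub_C_of_irreducible_of_eval_eq_zero hπi hπm h1
    rwa [map_one] at h)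
  rcases seedS_cases he P with ⟨hlt, -, -, h⟩ | ⟨-, -, -, h⟩ | ⟨-, -, -, h⟩ | ⟨-, hDz, -, -, hhz⟩
  · rw [h π₀ hπi.ne_zero] at hP
    have h5 : (π₀.natDegree : ℤ) * P.ord 𝔤(K) ≤ 0 :=
      mul_nonpos_of_nonneg_of_nonpos (by positivity) hlt.le
    exact absurd hP (not_lt.2 h5)
  · rw [h π₀ h0] at hP; exact (lt_irrefl _ hP).elim
  · rw [h π₀ h1] at hP; exact (lt_irrefl _ hP).elim
  refine ⟨?_, hhz⟩
  obtain ⟨hT, -, -, hD, -⟩ := seedS_ne_zero (K := K) 0 0 0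
  obtain ⟨h1728, ho1728⟩ := seedI_const (K := K) P
  -- the homogenised pull-back of `π₀` under `A/B`
  set A : K[X] := 𝔗(K) ^ 2 with hA
  set B : K[X] := C (1728 : K) * 𝔡(K) with hB
  set N : K[X] := ∑ j ∈ Finset.range (π₀.natDegree + 1),
    C (π₀.coeff j) * A ^ j * B ^ (π₀.natDegree - j) with hN
  have haB : aeval (RatFunc.X : RatFunc K) B = algebraMap K (RatFunc K) 1728 * 𝔡ᵥ(K) := by
    rw [hB, map_mul (aeval RatFunc.X) (C (1728 : K)), aeval_C]
  have haB0 : aeval (RatFunc.X : RatFunc K) B ≠ 0 := by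
    rw [haB]; exact mul_ne_zero h1728 hD
  have hNf : aeval (RatFunc.X : RatFunc K) N = aeval (RatFunc.X : RatFunc K) B ^ π₀.natDegree *
      aeval 𝔤(K) π₀ := by
    rw [hN, aeval_pullback_eq π₀ A B haB0, ← seedS_eq_div]
  have hπf0 : aeval 𝔤(K) π₀ ≠ 0 := seedS_transcendental.2.2 _ hπi.ne_zero
  have hN0 : N ≠ 0 := by
    intro h
    rw [h, map_zero] at hNf
    exact mul_ne_zero (pow_ne_zero _ haB0) hπf0 hNf.symm
  -- coprimality and the Wronskian
  have hu : IsUnit (C (1728 : K) : K[X]) := isUnit_C.mpr (by norm_num : (1728 : K) ≠ 0).isUnit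
  have hcop : IsCoprime A B := by
    have h1 : IsCoprime (𝔗(K) ^ 2) (C (1728 : K)) := by
      simpa using (isCoprime_mul_unit_left_right hu (𝔗(K) ^ 2) 1).2 isCoprime_one_right
    rw [hA, hB]
    exact h1.mul_right (isCoprime_lvT (K := K)).1.pow_left
  have hW : ∀ ρ : K[X], Irreducible ρ → ρ ∣ derivative A * B - A * derivative B →
      ρ ∣ A ∨ ρ ∣ B ∨ ρ ∣ A - B := by
    intro ρ hρ hdvd
    rw [hA, hB, wronskian_lv] at hdvd
    have hp := hρ.prime
    rcases hp.dvd_or_dvd hdvd with h | h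
    · rcases hp.dvd_or_dvd h with h | h
      · rcases hp.dvd_or_dvd h with h | h
        · exact (hρ.not_isUnit (isUnit_of_dvd_unit h hu)).elim
        · left; rw [hA]; exact h.trans (dvd_pow_self _ two_ne_zero)
      · right; left; rw [hB]
        refine dvd_mul_of_dvd_right ?_ _
        rcases hp.dvd_or_dvd h with h | h
        · exact dvd_mul_of_dvd_left (dvd_mul_of_dvd_left ((hp.dvd_of_dvd_pow h).trans
            (dvd_pow_self _ (by norm_num))) _) _
        · exact dvd_mul_of_dvd_left (dvd_mul_of_dvd_right ((hp.dvd_of_dvd_pow h).trans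
            (dvd_pow_self _ (by norm_num))) _) _
    · right; right
      have h5 : ρ ∣ ℌ(K) ^ 2 := by
        rcases hp.dvd_or_dvd h with h | h
        · rw [show (-7 : K[X]) = C (-7 : K) by rw [map_neg, map_ofNat]] at h
          exact (hρ.not_isUnit (isUnit_of_dvd_unit h
            (isUnit_C.mpr (by norm_num : (-7 : K) ≠ 0).isUnit))).elim
        · exact h
      have e : A - B = -(ℌ(K) ^ 3) := by
        rw [hA, hB, map_ofNat]
        linear_combination (-1 : K[X]) * lvH_pow_add_lvT_pow (K := K)
      rw [e, dvd_neg]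
      exact (hp.dvd_of_dvd_pow h5).trans (dvd_pow_self _ three_ne_zero)
  have hsep : N.Separable := pullback_separable hπi hπm hπX hπX1 hcop hW hN0
  have hordB : P.ord (aeval (RatFunc.X : RatFunc K) B) = 0 := by
    rw [haB, P.ord_mul_eq h1728 hD, hDz, ho1728]; norm_num
  have hordN : P.ord (aeval (RatFunc.X : RatFunc K) N) = P.ord (aeval 𝔤(K) π₀) := by
    rw [hNf, P.ord_mul_eq (pow_ne_zero _ haB0) hπf0, P.ord_pow haB0, hordB, mul_zero, zero_add]
  have h := P.ord_aeval_eq_one_of_separable_of_finrank_eq_one hut hu1 hsep (by rw [hordN]; exact hP)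
  rwa [hordN] at h

/-- **The radicand `𝔥` of the Kummer layer**: its order is `7`-divisible at the zeros of `𝔤` (where
`v(𝔤) = 2`). [folklore] -/
theorem seedS_zeros {e₁ e₂ e₃ : K} (he : 𝔠(K) = (X - C e₁) * (X - C e₂) * (X - C e₃))
    (P : PlaceOver K (RatFunc K)) (hP : 0 < P.ord 𝔤(K)) :
    P.ord 𝔤(K) = 2 ∧ ((7 : ℕ) : ℤ) ∣ P.ord 𝔥(K, e₁, e₂, e₃) := by
  rcases seedS_cases he P with ⟨hg, -⟩ | ⟨hg, -, hh, -⟩ | ⟨hg, -⟩ | ⟨-, -, hg, -⟩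
  · omega
  · exact ⟨hg, by rw [hh]; exact dvd_zero _⟩
  · omega
  · omega

/-- The order of the radicand is `7`-divisible at the zeros of `𝔤 - 1` (where `v(𝔤 - 1) = 3`). [folklore] -/
theorem seedS_ones {e₁ e₂ e₃ : K} (he : 𝔠(K) = (X - C e₁) * (X - C e₂) * (X - C e₃))
    (P : PlaceOver K (RatFunc K)) (hP : 0 < P.ord (𝔤(K) - 1)) :
    P.ord (𝔤(K) - 1) = 3 ∧ ((7 : ℕ) : ℤ) ∣ P.ord 𝔥(K, e₁, e₂, e₃) := by
  rcases seedS_cases he P with ⟨hg, hg1, -⟩ | ⟨-, hg, -⟩ | ⟨-, hg, hh, -⟩ | ⟨-, -, -, hg, -⟩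
  · omega
  · omega
  · exact ⟨hg, by rw [hh]; exact dvd_zero _⟩
  · omega

/-- **At the poles of `𝔤` the layer is of the two kinds**: either `v(𝔤) = -7` and `7 ∣ v(𝔥)` (the cusps
of width `7`), or `7 v(𝔤) = -7` and `v(𝔥)` is prime to `7` (the cusps of width `1`) — the hypothesis of the
even companion's `PlaceOver.ord_algebraMap_eq_of_forall_ord_neg_mixed`. [folklore] -/
theorem seedS_poles {e₁ e₂ e₃ : K} (he : 𝔠(K) = (X - C e₁) * (X - C e₂) * (X - C e₃))
    (P : PlaceOver K (RatFunc K)) (hP : P.ord 𝔤(K) < 0) :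
    (P.ord 𝔤(K) = -7 ∧ ((7 : ℕ) : ℤ) ∣ P.ord 𝔥(K, e₁, e₂, e₃)) ∨
      (((7 : ℕ) : ℤ) * P.ord 𝔤(K) = -7 ∧ IsCoprime (P.ord 𝔥(K, e₁, e₂, e₃)) ((7 : ℕ) : ℤ)) := by
  rcases seedS_cases he P with ⟨-, -, hab, -⟩ | ⟨hg, -⟩ | ⟨hg, -⟩ | ⟨-, -, hg, -⟩
  · rcases hab with ⟨hg, hh⟩ | ⟨hg, hh⟩
    · left; exact ⟨hg, by exact_mod_cast hh⟩
    · right; exact ⟨by rw [hg]; norm_num, by exact_mod_cast hh⟩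
  · omega
  · omega
  · omega

/-- At the other closed points the radicand is a unit. [folklore] -/
theorem seedS_elsewhere_dvd {e₁ e₂ e₃ : K} (he : 𝔠(K) = (X - C e₁) * (X - C e₂) * (X - C e₃))
    {π₀ : K[X]} (hπi : Irreducible π₀) (hπm : π₀.Monic) (hπX : π₀ ≠ X) (hπX1 : π₀ ≠ X - 1)
    (P : PlaceOver K (RatFunc K)) (hP : 0 < P.ord (aeval 𝔤(K) π₀)) :
    P.ord (aeval 𝔤(K) π₀) = 1 ∧ ((7 : ℕ) : ℤ) ∣ P.ord 𝔥(K, e₁, e₂, e₃) := by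
  obtain ⟨h1, hh⟩ := seedS_elsewhere he hπi hπm hπX hπX1 P hP
  exact ⟨h1, by rw [hh]; exact dvd_zero _⟩

end Seed

/-! ### C. One Kummer layer of degree `7`: the covering of signature `(2, 3, 7)` -/

section Cover

/-- **One Kummer layer over the `j`-map of `X₁(7)`: a covering of signature `(2, 3, 7)`** over (the full
constant field inside `F₁` of) any number field `K` over which the cusp form splits,
`𝔠 = (X - e₁)(X - e₂)(X - e₃)`: `F₁ = K(v)(g)`, `g⁷ = (v - e₁)(v - e₂)²(v - e₃)⁴`, and
`f = 𝔗(v)²/(1728 𝔡(v)) = 1 - j(E_v)/1728`. [cite: Stichtenoth2009, Prop. 3.7.3]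
[cite: DarmonGranville1995, Prop. 3.1 (p. 525), signature `(2, 3, 7)`] -/
theorem exists_belyiMap_signature_two_three_seven_aux (K : Type u) [Field K] [NumberField K]
    {e₁ e₂ e₃ : K} (he : 𝔠(K) = (X - C e₁) * (X - C e₂) * (X - C e₃)) :
    ∃ (K' : Type u) (_ : Field K') (_ : NumberField K') (F : Type u) (_ : Field F) (_ : Algebra K' F)
      (_ : IsAlgFunctionField K' F) (_ : IsIntegrallyClosedIn K' F) (f : F),
      f ∉ Set.range (algebraMap K' F) ∧
      (∀ P : PlaceOver K' F, 0 < P.ord f → P.ord f = 2) ∧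
      (∀ P : PlaceOver K' F, 0 < P.ord (f - 1) → P.ord (f - 1) = 3) ∧
      (∀ P : PlaceOver K' F, P.ord f < 0 → P.ord f = -7) ∧
      (∀ π₀ : K'[X], Irreducible π₀ → π₀.Monic → π₀ ≠ X → π₀ ≠ X - 1 →
        ∀ P : PlaceOver K' F, 0 < P.ord (aeval f π₀) → P.ord (aeval f π₀) = 1) := by
  haveI : CharZero (RatFunc K) :=
    charZero_of_injective_algebraMap (algebraMap K (RatFunc K)).injective
  have h7 : 0 < 7 := by norm_num
  have h7K : ((7 : ℕ) : K) ≠ 0 := Nat.cast_ne_zero.2 (by norm_num)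
  obtain ⟨-, -, -, -, hH0⟩ := seedS_ne_zero (K := K) e₁ e₂ e₃
  -- the Kummer layer
  obtain ⟨F₁, _, _, _, _, _, _, g, hg, hgen⟩ := exists_radical_extension (K := K) (F := RatFunc K)
    𝔥(K, e₁, e₂, e₃) h7
  haveI hAF₁ : IsAlgFunctionField K F₁ :=
    isAlgFunctionField_of_finiteDimensional (K := K) (F := RatFunc K)
  set f : F₁ := algebraMap (RatFunc K) F₁ 𝔤(K) with hf
  have hft : Transcendental K f :=
    (transcendental_algebraMap_iff (algebraMap (RatFunc K) F₁).injective).2 seedS_transcendental.2.1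
  have h₀ : ∀ R : PlaceOver K F₁, 0 < R.ord f → R.ord f = 2 := fun R hR =>
    PlaceOver.ord_algebraMap_eq_of_forall_ord_pos_of_dvd (K := K) (F := RatFunc K) (F' := F₁) h7 h7K
      hH0 hg hgen (fun Q hQ => seedS_zeros he Q hQ) R hR
  have hi' : ∀ R : PlaceOver K F₁, R.ord f < 0 → R.ord f = -7 := fun R hR =>
    PlaceOver.ord_algebraMap_eq_of_forall_ord_neg_mixed (K := K) (F := RatFunc K) (F' := F₁) h7 h7K
      hH0 hg hgen (p₀ := -7) (fun Q hQ => seedS_poles he Q hQ) R hR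
  have h₁ : ∀ R : PlaceOver K F₁, 0 < R.ord (f - 1) → R.ord (f - 1) = 3 := by
    intro R hR
    have heq : f - 1 = algebraMap (RatFunc K) F₁ (𝔤(K) - 1) := by
      simp only [hf, map_sub, map_one]
    rw [heq] at hR ⊢
    exact PlaceOver.ord_algebraMap_eq_of_forall_ord_pos_of_dvd (K := K) (F := RatFunc K) (F' := F₁) h7
      h7K hH0 hg hgen (fun Q hQ => seedS_ones he Q hQ) R hR
  have hunr : ∀ π₀ : K[X], Irreducible π₀ → π₀.Monic → π₀ ≠ X → π₀ ≠ X - 1 →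
      ∀ R : PlaceOver K F₁, 0 < R.ord (aeval f π₀) → R.ord (aeval f π₀) = 1 := by
    intro π₀ hπi hπm hX hX1 R hR
    have heq : aeval f π₀ = algebraMap (RatFunc K) F₁ (aeval 𝔤(K) π₀) := by
      rw [hf, aeval_algebraMap_apply]
    rw [heq] at hR ⊢
    exact PlaceOver.ord_algebraMap_eq_of_forall_ord_pos_of_dvd (K := K) (F := RatFunc K) (F' := F₁) h7
      h7K hH0 hg hgen (fun Q hQ => seedS_elsewhere_dvd he hπi hπm hX hX1 Q hQ) R hR
  obtain ⟨K', _, _, _, _, _, hfK', h₀', h₁', hi'', hunr'⟩ :=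
    exists_fullConstantField_of_signature (K := K) (F := F₁) hft h₀ h₁ hi' hunr
  exact ⟨K', inferInstance, inferInstance, F₁, inferInstance, inferInstance, inferInstance,
    inferInstance, f, hfK', h₀', h₁', hi'', hunr'⟩

/-- **The cusp form splits over `ℚ(ζ₇)`**: for `ζ⁶ + ζ⁵ + ζ⁴ + ζ³ + ζ² + ζ + 1 = 0`,
`X³ - 8 X² + 5 X + 1 = (X - e₁)(X - e₂)(X - e₃)` with `e_k = 2 + 3 η_k + η_k²`, `η_k = ζ^k + ζ^{7-k}`,
i.e. `e₁ = 4 + 3ζ + ζ² + ζ⁵ + 3ζ⁶`, `e₂ = 4 + 3ζ² + ζ³ + ζ⁴ + 3ζ⁵`, `e₃ = 4 + ζ + 3ζ³ + 3ζ⁴ + ζ⁶` (the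
cusps of `X₁(7)` of width `1` are rational over `ℚ(ζ₇)⁺`). [folklore] -/
theorem lvC_eq_mul {K : Type u} [Field K] {ζ : K} (hζ : ζ ^ 6 + ζ ^ 5 + ζ ^ 4 + ζ ^ 3 + ζ ^ 2 + ζ + 1 = 0) :
    𝔠(K) = (X - C (4 + 3 * ζ + ζ ^ 2 + ζ ^ 5 + 3 * ζ ^ 6)) *
      (X - C (4 + 3 * ζ ^ 2 + ζ ^ 3 + ζ ^ 4 + 3 * ζ ^ 5)) * (X - C (4 + ζ + 3 * ζ ^ 3 + 3 * ζ ^ 4 + ζ ^ 6)) := by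
  have hC : (C ζ) ^ 6 + (C ζ) ^ 5 + (C ζ) ^ 4 + (C ζ) ^ 3 + (C ζ) ^ 2 + C ζ + 1 = 0 := by
    have h := congr_arg (C : K → K[X]) hζ
    simpa only [map_add, map_pow, map_one, map_zero] using h
  simp only [map_add, map_mul, map_pow, map_ofNat]
  linear_combination (-(((-65 : K[X]) + C ζ - 12 * C ζ ^ 2 - 40 * C ζ ^ 3 - 21 * C ζ ^ 4 -
      37 * C ζ ^ 5 - 37 * C ζ ^ 6 + 19 * C ζ ^ 7 - 24 * C ζ ^ 8 - 25 * C ζ ^ 9 + 3 * C ζ ^ 10 -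
      9 * C ζ ^ 11) + ((43 : K[X]) - 11 * C ζ + 3 * C ζ ^ 2 + 10 * C ζ ^ 3 + 3 * C ζ ^ 4 + 10 * C ζ ^ 5 +
      3 * C ζ ^ 6) * X + (-4 : K[X]) * X ^ 2)) * hC

/-- **A covering of signature `(2, 3, 7)` over a number field**, in the shape of the covering input of
`finite_properSolutions_of_belyiMap_of_faltings`: the construction over the cyclotomic field `ℚ(ζ₇)`.
It has the degree `168`, the genus `3` and the signature of Klein's covering `X(7) → X(1)`, and is
obtained here as one Kummer layer of degree `7` over the `j`-map of `X₁(7)`; no Riemann existence theorem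
is used.
[cite: Stichtenoth2009, Prop. 3.7.3] [cite: DarmonGranville1995, Prop. 3.1 (p. 525), signature `(2, 3, 7)`] -/
theorem exists_belyiMap_signature_two_three_seven :
    ∃ (K : Type) (_ : Field K) (_ : NumberField K) (F : Type) (_ : Field F) (_ : Algebra K F)
      (_ : IsAlgFunctionField K F) (_ : IsIntegrallyClosedIn K F) (f : F),
      f ∉ Set.range (algebraMap K F) ∧
      (∀ P : PlaceOver K F, 0 < P.ord f → P.ord f = 2) ∧
      (∀ P : PlaceOver K F, 0 < P.ord (f - 1) → P.ord (f - 1) = 3) ∧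
      (∀ P : PlaceOver K F, P.ord f < 0 → P.ord f = -7) ∧
      (∀ π₀ : K[X], Irreducible π₀ → π₀.Monic → π₀ ≠ X → π₀ ≠ X - 1 →
        ∀ P : PlaceOver K F, 0 < P.ord (aeval f π₀) → P.ord (aeval f π₀) = 1) := by
  haveI : NeZero (7 : ℕ) := ⟨by norm_num⟩
  obtain ⟨ζ, hζ⟩ := @IsCyclotomicExtension.exists_isPrimitiveRoot {7} ℚ (CyclotomicField 7 ℚ) _ _ _
    (CyclotomicField.isCyclotomicExtension 7 ℚ) 7 (Set.mem_singleton 7) (NeZero.ne 7)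
  have h7 : ζ ^ 7 = 1 := hζ.pow_eq_one
  have h1 : ζ ^ 1 ≠ 1 := hζ.pow_ne_one_of_pos_of_lt one_ne_zero (by norm_num)
  have hrel : ζ ^ 6 + ζ ^ 5 + ζ ^ 4 + ζ ^ 3 + ζ ^ 2 + ζ + 1 = 0 := by
    have h : (ζ - 1) * (ζ ^ 6 + ζ ^ 5 + ζ ^ 4 + ζ ^ 3 + ζ ^ 2 + ζ + 1) = 0 := by linear_combination h7
    exact (mul_eq_zero.mp h).resolve_left (sub_ne_zero.mpr (by simpa using h1))
  exact exists_belyiMap_signature_two_three_seven_aux (CyclotomicField 7 ℚ) (lvC_eq_mul hrel)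

end Cover

end AlgFunctionField

/-! ### D. Darmon–Granville for the signatures `(p, q, r)` with `2 ∣ p`, `3 ∣ q`, `7 ∣ r`, modulo Faltings -/

section DarmonGranville

open AlgFunctionField

/-- **`A x^p + B y^q = C z^r` has finitely many proper solutions whenever `2 ∣ p`, `3 ∣ q`, `7 ∣ r`
(`p q r ≠ 0`), modulo Faltings' theorem** (`finite_ratPlaces_of_two_le_genus`): the covering
`exists_belyiMap_signature_two_three_seven` fed into `finite_properSolutions_of_belyiMap_of_faltings`
gives `(2, 3, 7)` (hyperbolic: `1/2 + 1/3 + 1/7 = 41/42`), and `finite_properSolutions_of_dvd` the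
multiples. In particular `x² + y³ = z⁷` (Poonen–Schaefer–Stoll) has finitely many proper solutions
modulo Faltings only. No Riemann existence theorem is used. [cite: DarmonGranville1995, Theorem 2 (p. 515)] -/
theorem finite_properSolutions_signature_two_three_seven_of_faltings {p q r : ℕ}
    (hp : 2 ∣ p) (hq : 3 ∣ q) (hr : 7 ∣ r) (hp0 : p ≠ 0) (hq0 : q ≠ 0) (hr0 : r ≠ 0)
    (hFaltings : ∀ (K' : Type) [Field K'] (F' : Type) [Field F'] [Algebra K' F'],
      finite_ratPlaces_of_two_le_genus K' F')
    {A B C : ℤ} (hA : A ≠ 0) (hB : B ≠ 0) (hC : C ≠ 0) :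
    {t : ℤ × ℤ × ℤ | ({t.1, t.2.1, t.2.2} : Finset ℤ).gcd id = 1 ∧
      A * t.1 ^ p + B * t.2.1 ^ q = C * t.2.2 ^ r}.Finite := by
  obtain ⟨K, _, _, F, _, _, _, _, f, hf, h₀, h₁, hi, hunr⟩ := exists_belyiMap_signature_two_three_seven
  have hhyp : 3 * 7 + 7 * 2 + 2 * 3 < 2 * 3 * 7 := by norm_num
  exact finite_properSolutions_of_dvd hp hq hr hp0 hq0 hr0
    (finite_properSolutions_of_belyiMap_of_faltings hhyp hf h₀ h₁ (by exact_mod_cast hi) hunr hFaltings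
      hA hB hC)

/-- **`A x^r + B y² = C z³` has finitely many proper solutions for every `r ≠ 0` divisible by `7`,
modulo Faltings' theorem only** — in particular for `r = 7`, `49`, `343`, whose triangle groups
`Δ(2, 3, r)` are perfect. [cite: DarmonGranville1995, Theorem 2 (p. 515)] -/
theorem finite_properSolutions_signature_seven_two_three_of_faltings {r : ℕ} (hr0 : r ≠ 0) (h7 : 7 ∣ r)
    (hFaltings : ∀ (K' : Type) [Field K'] (F' : Type) [Field F'] [Algebra K' F'],
      finite_ratPlaces_of_two_le_genus K' F')
    {A B C : ℤ} (hA : A ≠ 0) (hB : B ≠ 0) (hC : C ≠ 0) :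
    {t : ℤ × ℤ × ℤ | ({t.1, t.2.1, t.2.2} : Finset ℤ).gcd id = 1 ∧
      A * t.1 ^ r + B * t.2.1 ^ 2 = C * t.2.2 ^ 3}.Finite := by
  have h23 : ∀ A B C : ℤ, A ≠ 0 → B ≠ 0 → C ≠ 0 →
      {t : ℤ × ℤ × ℤ | ({t.1, t.2.1, t.2.2} : Finset ℤ).gcd id = 1 ∧
        A * t.1 ^ 2 + B * t.2.1 ^ 3 = C * t.2.2 ^ r}.Finite := fun A B C hA hB hC =>
    finite_properSolutions_signature_two_three_seven_of_faltings dvd_rfl dvd_rfl h7 two_ne_zero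
      three_ne_zero hr0 hFaltings hA hB hC
  exact forall_finite_properSolutions_swap₁₂ (forall_finite_properSolutions_swap₂₃ h23) A B C hA hB hC

/-- **`A x^r + B y² = C z³` has finitely many proper solutions for every `r ≥ 7` not prime to `210`
(`2 ∣ r`, `3 ∣ r`, `5 ∣ r` or `7 ∣ r`), modulo Faltings' theorem only** — the union of the dihedral,
tetrahedral, icosahedral (`finite_properSolutions_signature_r_two_three_of_faltings_of_not_coprime_thirty`)
and level-`7` constructions. The remaining `r` (prime to `210`: `11, 13, 17, …, 121, 143, …`) are not
treated (they would need the modular curves `X(r)`). [cite: DarmonGranville1995, Theorem 2 (p. 515)] -/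
theorem finite_properSolutions_signature_r_two_three_of_faltings_of_not_coprime {r : ℕ}
    (hr : 7 ≤ r) (h2357 : 2 ∣ r ∨ 3 ∣ r ∨ 5 ∣ r ∨ 7 ∣ r)
    (hFaltings : ∀ (K' : Type) [Field K'] (F' : Type) [Field F'] [Algebra K' F'],
      finite_ratPlaces_of_two_le_genus K' F')
    {A B C : ℤ} (hA : A ≠ 0) (hB : B ≠ 0) (hC : C ≠ 0) :
    {t : ℤ × ℤ × ℤ | ({t.1, t.2.1, t.2.2} : Finset ℤ).gcd id = 1 ∧
      A * t.1 ^ r + B * t.2.1 ^ 2 = C * t.2.2 ^ 3}.Finite := by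
  by_cases h7 : 7 ∣ r
  · exact finite_properSolutions_signature_seven_two_three_of_faltings (by omega) h7 hFaltings hA hB hC
  · have h235 : 2 ∣ r ∨ 3 ∣ r ∨ 5 ∣ r := by tauto
    have h8 : 8 ≤ r := by
      rcases hr.lt_or_eq with h | h
      · omega
      · exact absurd (h ▸ dvd_rfl) h7
    exact finite_properSolutions_signature_r_two_three_of_faltings_of_not_coprime_thirty h8 h235
      hFaltings hA hB hC

end DarmonGranville

end Literature.NumberTheory.DiophantineGeometry
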